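import Summits.HodgeConjecture.HodgeConjecture.Theorems.LinearSystemTorelliLocalTubeSpanStarBasis

/-!
# Route LinearSystemTorelli — crux `LocalTubeSpan` (stmt-HodgeConjecture-2490): a star basis from the companion property

Helper file (`--supports stmt-HodgeConjecture-2490`, line `Sketch` of the crux chain, cycle 7,
lead c6): the star basis of `…LocalTubeSpanStarBasis` with the named fact `Janssen1983_thm2_9`
replaced by the companion property it actually uses (supplied from `Janssen1983_thm2_5` elsewhere
in cycle 7).

* `localTubeSpan_exists_starBasis_of_companions` — if a skew vanishing lattice `Δ` has the
  companion property (`δ ∈ Δ`, `y ∈ ℤΔ` with `⟨δ, y⟩ = 1`, `z ∈ ℤΔ` with `⟨z, y⟩ = 0` give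
  `δ + 2z ∈ Δ`), then `Δ` contains a `ℚ`-basis `δ₀, …` of `V` all of whose members pair to `1`
  with a distinguished member `δ_{i₀}` (a STAR for the unimodular graph): the companions
  `δ₁ + 2Nu ∈ Δ` (`u ⟂ δ₂`) span `δ₂^⟂`.

No named facts; no `sorry`.
-/

-- `Summit.HodgeConjecture.HodgeConjecture.Theorems` is the mandated namespace (single-conjunct summit:
-- Sub = Summit), which `linter.dupNamespace` flags on every declaration; the lakefile turns the
-- linter off tree-wide (weak option), restated here so stand-alone elaboration is warning-free too.
set_option linter.dupNamespace false

noncomputable section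

open Literature.AlgebraicGeometry.HodgeTheory

namespace Summit.HodgeConjecture.HodgeConjecture.Theorems

variable {V : Type} [AddCommGroup V] [Module ℚ V]

/-! ### A star basis from companions -/

/-- **A star basis inside a skew vanishing lattice with the companion property.**  A skew
vanishing lattice `Δ` in the finite-dimensional `ℚ`-space `V` (alternating `B`) such that
`δ + 2z ∈ Δ` whenever `δ ∈ Δ`, `y, z ∈ ℤΔ`, `⟨δ, y⟩ = 1`, `⟨z, y⟩ = 0`, contains linearly
independent `δ₀, …, δ_{r-1}`, `r = dim V`, and an index `i₀` with `⟨δᵢ, δ_{i₀}⟩ = 1` for all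
`i ≠ i₀`.  Proof: take `⟨δ₁, δ₂⟩ = 1` in `Δ` and `c = δ₂`; by the companion property every
`δ₁ + 2Nu` with `Nu ∈ ℤΔ`, `⟨u, c⟩ = 0`, lies in `Δ`, so the elements of `Δ` pairing to `1` with
`c` span `ℚδ₁ + c^⟂ = V`; extend `{c}` to a basis inside them.
[cite: Schnell2010, §7 Lemma 11 (proof, first step)] -/
theorem localTubeSpan_exists_starBasis_of_companions [FiniteDimensional ℚ V]
    (B : LinearMap.BilinForm ℚ V) (hB : B.IsAlt) (Δ : Set V) (hΔ : IsSkewVanishingLattice B Δ)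
    (hcomp : ∀ δ ∈ Δ, ∀ y ∈ Submodule.span ℤ Δ, B δ y = 1 →
      ∀ z ∈ Submodule.span ℤ Δ, B z y = 0 → δ + (2 : ℚ) • z ∈ Δ) :
    ∃ (r : ℕ) (δ : Fin r → V) (i₀ : Fin r), r = Module.finrank ℚ V ∧ (∀ i, δ i ∈ Δ) ∧
      LinearIndependent ℚ δ ∧ ∀ i, i ≠ i₀ → B (δ i) (δ i₀) = 1 := by
  classical
  -- `hB` belongs to the registered interface (as in `localTubeSpan_exists_starBasis`); the argument
  -- below does not need it.
  have _ := hB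
  obtain ⟨δ₁, hδ₁, c, hc, h1c⟩ := hΔ.exists_pair
  set Λ : Submodule ℤ V := Submodule.span ℤ Δ with hΛdef
  have hΛspan : Submodule.span ℚ (Λ : Set V) = ⊤ := by
    rw [hΛdef, Submodule.span_span_of_tower]; exact hΔ.span_eq_top
  -- the elements of `Δ` pairing to `1` with `c`
  set Δ₁ : Set V := {x | x ∈ Δ ∧ B x c = 1} with hΔ₁def
  have hδ₁Δ₁ : δ₁ ∈ Δ₁ := ⟨hδ₁, h1c⟩
  -- companions `δ₁ + 2 N u ∈ Δ₁` for `u ⟂ c`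
  have hcomp' : ∀ u : V, B u c = 0 → ∃ N : ℕ, 0 < N ∧ δ₁ + (2 * (N : ℚ)) • u ∈ Δ₁ := by
    intro u hu
    obtain ⟨N, hNpos, hNu⟩ := localTubeSpan_exists_nsmul_mem_of_span_eq_top Λ hΛspan u
    refine ⟨N, hNpos, ?_, ?_⟩
    · have hNu' : ((N : ℚ)) • u ∈ Submodule.span ℤ Δ := by
        rw [show ((N : ℚ)) • u = ((N : ℤ)) • u from
          (Int.cast_smul_eq_zsmul ℚ (N : ℤ) u).symm.trans (by rw [Int.cast_natCast]) |>.symm]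
        exact hNu
      have hzc : B (((N : ℚ)) • u) c = 0 := by
        rw [map_smul, LinearMap.smul_apply, hu, smul_zero]
      rw [mul_smul]
      exact hcomp δ₁ hδ₁ c (Submodule.subset_span hc) h1c ((N : ℚ) • u) hNu' hzc
    · rw [map_add, map_smul, LinearMap.add_apply, LinearMap.smul_apply, h1c, hu, smul_zero, add_zero]
  -- `Δ₁` spans `V`
  have hΔ₁span : Submodule.span ℚ Δ₁ = ⊤ := by
    refine eq_top_iff.2 fun v _ => ?_
    -- `v = (B v c) • δ₁ + u` with `u ⟂ c`
    set u : V := v - (B v c) • δ₁ with hudef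
    have hu : B u c = 0 := by
      rw [hudef, map_sub, map_smul, LinearMap.sub_apply, LinearMap.smul_apply, h1c, smul_eq_mul,
        mul_one, sub_self]
    obtain ⟨N, hNpos, hN⟩ := hcomp' u hu
    have hN0 : (2 * (N : ℚ)) ≠ 0 := by positivity
    have huspan : u ∈ Submodule.span ℚ Δ₁ := by
      have e1 : u = (2 * (N : ℚ))⁻¹ • ((δ₁ + (2 * (N : ℚ)) • u) - δ₁) := by
        rw [add_sub_cancel_left, smul_smul, inv_mul_cancel₀ hN0, one_smul]
      rw [e1]
      exact Submodule.smul_mem _ _ (Submodule.sub_mem _ (Submodule.subset_span hN)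
        (Submodule.subset_span hδ₁Δ₁))
    have e2 : v = (B v c) • δ₁ + u := by rw [hudef]; abel
    rw [e2]
    exact Submodule.add_mem _ (Submodule.smul_mem _ _ (Submodule.subset_span hδ₁Δ₁)) huspan
  -- extend `{c}` to a basis inside `{c} ∪ Δ₁`
  have hc0 : c ≠ 0 := by
    intro h0; rw [h0, map_zero] at h1c; exact zero_ne_one h1c
  have hcli : LinearIndepOn ℚ id ({c} : Set V) := (linearIndepOn_singleton_iff ℚ).2 hc0
  obtain ⟨b, hbsub, hcb, hbspan, hbli⟩ :=
    exists_linearIndepOn_id_extension hcli (Set.subset_union_left (t := Δ₁))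
  have hbtop : Submodule.span ℚ b = ⊤ := by
    refine eq_top_iff.2 ?_
    rw [← hΔ₁span, Submodule.span_le]
    exact fun x hx => hbspan (Or.inr hx)
  have hbfin : b.Finite := LinearIndependent.set_finite_of_isNoetherian hbli
  obtain ⟨r, f, hf⟩ := hbfin.fin_embedding
  have hfli : LinearIndependent ℚ f := by
    rw [← linearIndepOn_id_range_iff f.injective, hf]; exact hbli
  have hr : r = Module.finrank ℚ V := by
    have htop : Submodule.span ℚ (Set.range f) = ⊤ := by rw [hf, hbtop]
    have h1 := hfli.fintype_card_le_finrank
    have h2 := finrank_le_of_span_eq_top htop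
    rw [Fintype.card_fin] at h1 h2
    omega
  have hcb' : c ∈ Set.range f := by rw [hf]; exact hcb (Set.mem_singleton c)
  obtain ⟨i₀, hi₀⟩ := hcb'
  refine ⟨r, f, i₀, hr, fun i => ?_, hfli, fun i hi => ?_⟩
  · have hfi : f i ∈ b := hf ▸ Set.mem_range_self i
    rcases hbsub hfi with h | h
    · rw [Set.mem_singleton_iff.1 h]; exact hc
    · exact h.1
  · have hfi : f i ∈ b := hf ▸ Set.mem_range_self i
    have hne : f i ≠ c := fun h => hi (f.injective (h.trans hi₀.symm))
    rcases hbsub hfi with h | h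
    · exact absurd (Set.mem_singleton_iff.1 h) hne
    · rw [hi₀]; exact h.2

end Summit.HodgeConjecture.HodgeConjecture.Theorems

end
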